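import Literature.RingTheory.CentralSimple.DoubleCentralizer
import Mathlib.Algebra.Central.Matrix
import Mathlib.RingTheory.SimpleRing.Matrix
import Mathlib.LinearAlgebra.Matrix.ToLin

/-!
# Double-centraliser product bound — the commuting case of the product law (PL)
# (crux `GrenetZeon.DualUnipotentThreeHalves`, val-idea-31 g3; VP ≠ VNP is NOT proved)

Companion to `Cruxes/DualUnipotentThreeHalves/BiInflation.lean` (typed `CommutingProductBound`) and the card
`Ideas/graded-thin-side.md` (§BI, product law (PL)).  For the commuting two-sided inflations
`BiInfl₄(𝒜,ℬ) = J₄⊗𝒜 ⊕ R₂⊗ℬ` (nil by `biInfl_pow_four`) the product law reads `dim 𝒜 · dim ℬ ≤ k²`; this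
file proves it BY NAME from the tree's double centraliser theorem
(`Literature.RingTheory.CentralSimple.finrank_mul_finrank_centralizer`, Voight Prop. 7.7.8 (b):
`dim A · dim C_B(A) = dim B` for a simple subalgebra `A` of a central simple `B`) under the hypothesis that the
algebra generated by `𝒜` is simple: `𝒜 ⊆ a := alg(𝒜)`, `ℬ ⊆ C(a)`, so `dim 𝒜 · dim ℬ ≤ dim a · dim C(a) = k²`.
The remaining step of `CommutingProductBound` as typed (commuting + jointly generating `M_k` ⇒ `alg(𝒜)`
simple, via `rad(a)·b` a nilpotent ideal of `M_k`) is left as prover food.  0 sorry.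
-/

namespace Summit.ValiantsHypothesis.ValiantsHypothesis.Cruxes.DualUnipotentThreeHalves.GradedThinSide

open Module

/-- **Commuting product bound, simple case.**  If `𝒜, ℬ ⊆ M_k(ℂ)` commute elementwise and the subalgebra
generated by `𝒜` is simple, then `dim 𝒜 · dim ℬ ≤ k²` (double centraliser). -/
theorem finrank_mul_finrank_le_sq_of_commute (k : ℕ) (hk : 0 < k)
    (𝒜 ℬ : Submodule ℂ (Matrix (Fin k) (Fin k) ℂ))
    [IsSimpleRing ↥(Algebra.adjoin ℂ (𝒜 : Set (Matrix (Fin k) (Fin k) ℂ)))]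
    (hcomm : ∀ A ∈ 𝒜, ∀ B ∈ ℬ, A * B = B * A) :
    finrank ℂ 𝒜 * finrank ℂ ℬ ≤ k ^ 2 := by
  haveI : Nonempty (Fin k) := ⟨⟨0, hk⟩⟩
  set a : Subalgebra ℂ (Matrix (Fin k) (Fin k) ℂ) := Algebra.adjoin ℂ (𝒜 : Set (Matrix (Fin k) (Fin k) ℂ))
    with ha
  have h1 : finrank ℂ 𝒜 ≤ finrank ℂ ↥a := by
    rw [← Subalgebra.finrank_toSubmodule]
    apply Submodule.finrank_mono
    intro x hx
    rw [Subalgebra.mem_toSubmodule, ha]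
    exact Algebra.subset_adjoin hx
  have h2 : finrank ℂ ℬ ≤ finrank ℂ ↥(Subalgebra.centralizer ℂ (a : Set (Matrix (Fin k) (Fin k) ℂ))) := by
    rw [← Subalgebra.finrank_toSubmodule]
    apply Submodule.finrank_mono
    intro B hB
    rw [Subalgebra.mem_toSubmodule, Subalgebra.mem_centralizer_iff]
    intro x hx
    have hx' : x ∈ Algebra.adjoin ℂ (𝒜 : Set (Matrix (Fin k) (Fin k) ℂ)) := by rw [← ha]; exact hx
    have hc : Commute B x :=
      Algebra.commute_of_mem_adjoin_of_forall_mem_commute hx' (fun A hA => (hcomm A hA B hB).symm)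
    exact hc.eq.symm
  have h3 := Literature.RingTheory.CentralSimple.finrank_mul_finrank_centralizer
    (F := ℂ) (B := Matrix (Fin k) (Fin k) ℂ) a
  have h4 : finrank ℂ (Matrix (Fin k) (Fin k) ℂ) = k ^ 2 := by
    simp [Module.finrank_matrix, sq]
  calc finrank ℂ 𝒜 * finrank ℂ ℬ
      ≤ finrank ℂ ↥a * finrank ℂ ↥(Subalgebra.centralizer ℂ (a : Set (Matrix (Fin k) (Fin k) ℂ))) :=
        Nat.mul_le_mul h1 h2
    _ = k ^ 2 := by rw [h3, h4]

end Summit.ValiantsHypothesis.ValiantsHypothesis.Cruxes.DualUnipotentThreeHalves.GradedThinSide
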